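import Mathlib.Analysis.Complex.Exponential
import Mathlib.Analysis.SpecialFunctions.Trigonometric.Basic
import Mathlib.Analysis.SpecificLimits.Normed
import HarnessLib

/-!
# RH-FREE toolbox for the corner gap (L2 of `ScrewManifestCornerGap`): mass recovery for nonnegative cosine sums

A band-limited cosine sum with NONNEGATIVE coefficients cannot be uniformly small on the window `[2, 5/2]`
unless its total mass is small:

* `cosSum_mass_le_of_small_on_window` : for every `θ ≥ 0` there is `C > 0` such that for all `V_k ≥ 0`,
  `0 ≤ τ_k ≤ θ` and `η` with `|Σ_k V_k cos(τ_k s)| ≤ η` for all `s ∈ [2, 5/2]`, one has `Σ_k V_k ≤ C·η`.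

Proof (explicit, no compactness): `1 = Re(e^{2iτ} e^{−2iτ})`; with `x = τh`, `w = e^{ix} − 1`, `m = 2/h`,
`e^{−2iτ} = e^{−mw}·e^{z}` with `‖z‖ = m‖w − ix‖ ≤ 2τ²h` (`Complex.norm_exp_sub_one_sub_id_le`), and
`e^{−mw}` is within `2(4θ)^N/N!` of its Taylor polynomial `Σ_{n<N} (−mw)^n/n!` (`Complex.exp_bound'`,
`‖mw‖ ≤ 4τ`); expanding `w^n = (e^{ix} − 1)^n` binomially, `Re(e^{2iτ}(−mw)^n)` is a combination of
`cos((2 + jh)τ)`, `j ≤ n`, i.e. of cosines at the NODES `2 + jh ∈ [2, 5/2]`.  Hence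
`|1 − P(τ)| ≤ 1/2` on `[0, θ]` for an explicit finite combination `P` of node cosines, and summing against
`V_k ≥ 0` gives `Σ V_k ≤ ½ Σ V_k + (Σ|coeff|)·η`.

RH-FREE elementary analysis; nothing here bears on the truth of RH.  References: [folklore]
(a Turán-type lemma for positive-coefficient trigonometric sums).
-/

set_option linter.dupNamespace false
set_option autoImplicit false

noncomputable section

open Complex Finset

namespace Summit.RiemannHypothesis.RiemannHypothesis.Theorems.IntegerScrew.Manifest

/-- Binomial expansion into node cosines: for real `t, x` and `n : ℕ`,
`Re(e^{it}(e^{ix} − 1)^n) = Σ_{j ≤ n} (−1)^{n−j} C(n,j) cos(t + j x)`. [folklore] -/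
theorem re_exp_mul_exp_sub_one_pow (t x : ℝ) (n : ℕ) :
    (cexp (t * I) * (cexp (x * I) - 1) ^ n).re
      = ∑ j ∈ range (n + 1), ((-1 : ℝ) ^ (n - j) * (n.choose j : ℝ)) * Real.cos (t + j * x) := by
  rw [sub_eq_add_neg, add_pow, mul_sum, Complex.re_sum]
  refine sum_congr rfl fun j _ => ?_
  have e1 : cexp (↑t * I) * cexp (↑x * I) ^ j = cexp (↑(t + ↑j * x) * I) := by
    rw [← Complex.exp_nat_mul, ← Complex.exp_add]
    congr 1
    push_cast
    ring
  have e2 : cexp (↑t * I) * (cexp (↑x * I) ^ j * (-1) ^ (n - j) * ↑(n.choose j))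
      = ↑((-1 : ℝ) ^ (n - j) * (n.choose j : ℝ)) * cexp (↑(t + ↑j * x) * I) := by
    rw [show cexp (↑t * I) * (cexp (↑x * I) ^ j * (-1) ^ (n - j) * ↑(n.choose j))
        = ((-1) ^ (n - j) * ↑(n.choose j)) * (cexp (↑t * I) * cexp (↑x * I) ^ j) by ring, e1]
    push_cast
    ring
  rw [e2, Complex.re_ofReal_mul, Complex.exp_ofReal_mul_I_re]

/-- The node-cosine approximation of `1` on the band `[0, θ]`: with `m = 2/h` and
`P(τ) = Σ_{n<N} Σ_{j≤n} ((−m)^n/n!)·(−1)^{n−j} C(n,j)·cos((2 + jh)τ)`, if `θh ≤ 1`, `16θ²h ≤ 1`,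
`8θ ≤ N + 1` and `8(4θ)^N ≤ N!`, then `|1 − P(τ)| ≤ 1/2` for `0 ≤ τ ≤ θ`. [folklore] -/
theorem abs_one_sub_nodeApprox_le {θ h : ℝ} {N : ℕ} (hh : 0 < h) (hθh : θ * h ≤ 1)
    (hθ2h : 16 * θ ^ 2 * h ≤ 1) (hN1 : 8 * θ ≤ (N : ℝ) + 1)
    (hN2 : 8 * (4 * θ) ^ N ≤ (N.factorial : ℝ)) {τ : ℝ} (hτ0 : 0 ≤ τ) (hτθ : τ ≤ θ) :
    |1 - ∑ n ∈ range N, ∑ j ∈ range (n + 1),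
        ((-(2 / h)) ^ n / (n.factorial : ℝ) * ((-1 : ℝ) ^ (n - j) * (n.choose j : ℝ)))
          * Real.cos ((2 + j * h) * τ)| ≤ 1 / 2 := by
  have hθ0 : 0 ≤ θ := le_trans hτ0 hτθ
  -- the objects
  set x : ℝ := τ * h with hx
  set m : ℝ := 2 / h with hm
  set w : ℂ := cexp (↑x * I) - 1 with hw
  set X : ℂ := ((-m : ℝ) : ℂ) * w with hX
  set S : ℂ := ∑ n ∈ range N, X ^ n / (n.factorial : ℂ) with hS
  have hx0 : 0 ≤ x := mul_nonneg hτ0 hh.le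
  have hx1 : x ≤ 1 := le_trans (mul_le_mul_of_nonneg_right hτθ hh.le) hθh
  have hxθ : x ≤ θ * h := mul_le_mul_of_nonneg_right hτθ hh.le
  have hm0 : 0 < m := by positivity
  have hmx : m * x = 2 * τ := by rw [hm, hx]; field_simp
  have hnix : ‖(x : ℂ) * I‖ = x := by simp [abs_of_nonneg hx0]
  -- `‖w − ix‖ ≤ x²`, `‖w‖ ≤ 2x`
  have hw1 : ‖w - ↑x * I‖ ≤ x ^ 2 := by
    have h1 := Complex.norm_exp_sub_one_sub_id_le (x := ↑x * I) (by rw [hnix]; exact hx1)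
    rw [hnix] at h1
    simpa [hw] using h1
  have hw2 : ‖w‖ ≤ 2 * x := by
    have h1 := Complex.norm_exp_sub_one_le (x := ↑x * I) (by rw [hnix]; exact hx1)
    rw [hnix] at h1
    simpa [hw] using h1
  -- `X = −2τ i + z`, `z = −m (w − ix)`, `‖z‖ ≤ 2τ²h ≤ 1/8`
  set z : ℂ := -(m : ℂ) * (w - ↑x * I) with hz
  have hXz : X = ↑(-(2 * τ)) * I + z := by
    rw [hX, hz, show ((-(2 * τ) : ℝ) : ℂ) = -((m : ℂ) * (x : ℂ)) by
      rw [← Complex.ofReal_mul, hmx]; push_cast; ring]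
    push_cast
    ring
  have hz1 : ‖z‖ ≤ 1 / 8 := by
    have e : ‖z‖ = m * ‖w - ↑x * I‖ := by
      rw [hz, norm_mul, norm_neg, Complex.norm_real, Real.norm_eq_abs, abs_of_pos hm0]
    rw [e]
    have h1 : m * ‖w - ↑x * I‖ ≤ m * x ^ 2 := mul_le_mul_of_nonneg_left hw1 hm0.le
    have h2 : m * x ^ 2 = 2 * τ * x := by rw [pow_two, ← mul_assoc, hmx]
    have h3 : 2 * τ * x ≤ 2 * θ * (θ * h) :=
      mul_le_mul (by linarith) hxθ hx0 (by positivity)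
    nlinarith
  have hez : ‖cexp z - 1‖ ≤ 1 / 4 := by
    have h1 := Complex.norm_exp_sub_one_le (x := z) (by linarith)
    linarith
  -- `‖exp X − exp(−2τ i)‖ ≤ 1/4`
  have hA : ‖cexp X - cexp (↑(-(2 * τ)) * I)‖ ≤ 1 / 4 := by
    have e : cexp X - cexp (↑(-(2 * τ)) * I) = cexp (↑(-(2 * τ)) * I) * (cexp z - 1) := by
      rw [hXz, Complex.exp_add]; ring
    rw [e, norm_mul, Complex.norm_exp_ofReal_mul_I, one_mul]
    exact hez
  -- `‖exp X − S‖ ≤ 2(4θ)^N/N! ≤ 1/4`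
  have hXn : ‖X‖ ≤ 4 * θ := by
    have e : ‖X‖ = m * ‖w‖ := by
      rw [hX, norm_mul, Complex.norm_real, Real.norm_eq_abs, abs_neg, abs_of_pos hm0]
    rw [e]
    calc m * ‖w‖ ≤ m * (2 * x) := mul_le_mul_of_nonneg_left hw2 hm0.le
      _ = 4 * τ := by rw [← mul_assoc, mul_comm m 2, mul_assoc, hmx]; ring
      _ ≤ 4 * θ := by linarith
  have hB : ‖cexp X - S‖ ≤ 1 / 4 := by
    have hcond : ‖X‖ / (N.succ : ℝ) ≤ 1 / 2 := by
      rw [div_le_iff₀ (by positivity)]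
      have : (N.succ : ℝ) = (N : ℝ) + 1 := by push_cast; ring
      rw [this]
      linarith
    have h1 := Complex.exp_bound' (x := X) (n := N) hcond
    have h2 : ‖X‖ ^ N / (N.factorial : ℝ) * 2 ≤ (4 * θ) ^ N / (N.factorial : ℝ) * 2 := by
      gcongr
    have h3 : (4 * θ) ^ N / (N.factorial : ℝ) * 2 ≤ 1 / 4 := by
      rw [div_mul_eq_mul_div, div_le_iff₀ (by positivity)]
      linarith
    calc ‖cexp X - S‖ = ‖cexp X - ∑ n ∈ range N, X ^ n / (n.factorial : ℂ)‖ := by rw [hS]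
      _ ≤ ‖X‖ ^ N / (N.factorial : ℝ) * 2 := h1
      _ ≤ 1 / 4 := le_trans h2 h3
  -- hence `‖exp(−2τ i) − S‖ ≤ 1/2`
  have hC : ‖cexp (↑(-(2 * τ)) * I) - S‖ ≤ 1 / 2 := by
    have e : cexp (↑(-(2 * τ)) * I) - S = (cexp X - S) - (cexp X - cexp (↑(-(2 * τ)) * I)) := by ring
    rw [e]
    calc ‖(cexp X - S) - (cexp X - cexp (↑(-(2 * τ)) * I))‖
        ≤ ‖cexp X - S‖ + ‖cexp X - cexp (↑(-(2 * τ)) * I)‖ := norm_sub_le _ _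
      _ ≤ 1 / 4 + 1 / 4 := add_le_add hB hA
      _ = 1 / 2 := by norm_num
  -- the real part identity: `1 − P(τ) = Re(e^{2τ i}(e^{−2τ i} − S))`
  have hre : 1 - ∑ n ∈ range N, ∑ j ∈ range (n + 1),
        ((-(2 / h)) ^ n / (n.factorial : ℝ) * ((-1 : ℝ) ^ (n - j) * (n.choose j : ℝ)))
          * Real.cos ((2 + j * h) * τ)
      = (cexp (↑(2 * τ) * I) * (cexp (↑(-(2 * τ)) * I) - S)).re := by
    have e1 : cexp (↑(2 * τ) * I) * cexp (↑(-(2 * τ)) * I) = 1 := by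
      rw [← Complex.exp_add, ← Complex.exp_zero]
      congr 1
      push_cast
      ring
    rw [mul_sub, e1, Complex.sub_re, Complex.one_re, hS, mul_sum, Complex.re_sum]
    congr 1
    refine sum_congr rfl fun n _ => ?_
    have e2 : cexp (↑(2 * τ) * I) * (X ^ n / (n.factorial : ℂ))
        = ↑((-(2 / h)) ^ n / (n.factorial : ℝ)) * (cexp (↑(2 * τ) * I) * w ^ n) := by
      rw [hX, mul_pow, ← hm]
      push_cast
      ring
    rw [e2, Complex.re_ofReal_mul, re_exp_mul_exp_sub_one_pow, mul_sum]
    refine sum_congr rfl fun j _ => ?_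
    have e3 : 2 * τ + ↑j * x = (2 + ↑j * h) * τ := by rw [hx]; ring
    rw [e3]
    ring
  rw [hre]
  calc |(cexp (↑(2 * τ) * I) * (cexp (↑(-(2 * τ)) * I) - S)).re|
      ≤ ‖cexp (↑(2 * τ) * I) * (cexp (↑(-(2 * τ)) * I) - S)‖ := Complex.abs_re_le_norm _
    _ = ‖cexp (↑(-(2 * τ)) * I) - S‖ := by
        rw [norm_mul, Complex.norm_exp_ofReal_mul_I, one_mul]
    _ ≤ 1 / 2 := hC

/-- Admissible parameters exist: for every `θ ≥ 0` there are `N ≥ 1` and `h > 0` with `θh ≤ 1`,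
`16θ²h ≤ 1`, `8θ ≤ N + 1`, `8(4θ)^N ≤ N!` and `N·h ≤ 1/2` (so the nodes `2 + jh`, `j < N`, lie in
`[2, 5/2]`). [folklore] -/
theorem exists_nodeApprox_params {θ : ℝ} (hθ : 0 ≤ θ) :
    ∃ (N : ℕ) (h : ℝ), 1 ≤ N ∧ 0 < h ∧ θ * h ≤ 1 ∧ 16 * θ ^ 2 * h ≤ 1 ∧ 8 * θ ≤ (N : ℝ) + 1 ∧
      8 * (4 * θ) ^ N ≤ (N.factorial : ℝ) ∧ (N : ℝ) * h ≤ 1 / 2 := by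
  -- `(4θ)^N / N! → 0`
  have ht : Filter.Tendsto (fun N : ℕ => (4 * θ) ^ N / (N.factorial : ℝ)) Filter.atTop (nhds 0) :=
    (Real.summable_pow_div_factorial (4 * θ)).tendsto_atTop_zero
  have h1 : ∀ᶠ N : ℕ in Filter.atTop, (4 * θ) ^ N / (N.factorial : ℝ) < 1 / 8 :=
    (ht.eventually (gt_mem_nhds (by norm_num : (0 : ℝ) < 1 / 8)))
  have h2 : ∀ᶠ N : ℕ in Filter.atTop, 8 * θ ≤ (N : ℝ) + 1 := by
    obtain ⟨M, hM⟩ := exists_nat_ge (8 * θ)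
    refine Filter.eventually_atTop.mpr ⟨M, fun N hN => ?_⟩
    have : (M : ℝ) ≤ N := by exact_mod_cast hN
    linarith
  have h3 : ∀ᶠ N : ℕ in Filter.atTop, 1 ≤ N := Filter.eventually_ge_atTop 1
  obtain ⟨N, ⟨hN1, hN2⟩, hN3⟩ := ((h1.and h2).and h3).exists
  refine ⟨N, 1 / (2 * (N : ℝ) + 16 * θ ^ 2 + θ + 2), hN3, by positivity, ?_, ?_, hN2, ?_, ?_⟩
  · rw [← div_eq_mul_one_div, div_le_one (by positivity)]
    have : (0 : ℝ) ≤ N := Nat.cast_nonneg N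
    nlinarith [sq_nonneg θ]
  · rw [← div_eq_mul_one_div, div_le_one (by positivity)]
    have : (0 : ℝ) ≤ N := Nat.cast_nonneg N
    nlinarith [sq_nonneg θ]
  · have hf : (0 : ℝ) < N.factorial := by positivity
    have := hN1
    rw [div_lt_iff₀ hf] at this
    linarith
  · rw [← div_eq_mul_one_div, div_le_iff₀ (by positivity)]
    have : (0 : ℝ) ≤ N := Nat.cast_nonneg N
    nlinarith [sq_nonneg θ]

/-- **Mass recovery for nonnegative band-limited cosine sums (RH-free).** For every `θ ≥ 0` there is
`C > 0` such that: if `V_k ≥ 0`, `0 ≤ τ_k ≤ θ`, and `|Σ_k V_k cos(τ_k s)| ≤ η` for every `s ∈ [2, 5/2]`,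
then `Σ_k V_k ≤ C·η`. [folklore] -/
theorem cosSum_mass_le_of_small_on_window {θ : ℝ} (hθ : 0 ≤ θ) :
    ∃ C : ℝ, 0 < C ∧ ∀ (K : ℕ) (V τ : Fin K → ℝ), (∀ k, 0 ≤ V k) → (∀ k, 0 ≤ τ k ∧ τ k ≤ θ) →
      ∀ η : ℝ, (∀ s : ℝ, 2 ≤ s → s ≤ 5 / 2 → |∑ k, V k * Real.cos (τ k * s)| ≤ η) →
        ∑ k, V k ≤ C * η := by
  obtain ⟨N, h, hN1, hh, hθh, hθ2h, hNθ, hNf, hNh⟩ := exists_nodeApprox_params hθ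
  -- the coefficients of the node approximation and the constant
  set c : ℕ → ℕ → ℝ := fun n j =>
    (-(2 / h)) ^ n / (n.factorial : ℝ) * ((-1 : ℝ) ^ (n - j) * (n.choose j : ℝ)) with hc
  set C : ℝ := 2 * ∑ n ∈ range N, ∑ j ∈ range (n + 1), |c n j| with hC
  have hCpos : 0 < C := by
    have h0 : (1 : ℝ) ≤ ∑ n ∈ range N, ∑ j ∈ range (n + 1), |c n j| := by
      have hmem : 0 ∈ range N := mem_range.mpr hN1
      have h00 : ∑ j ∈ range (0 + 1), |c 0 j| = 1 := by simp [hc]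
      calc (1 : ℝ) = ∑ j ∈ range (0 + 1), |c 0 j| := h00.symm
        _ ≤ ∑ n ∈ range N, ∑ j ∈ range (n + 1), |c n j| :=
            single_le_sum (f := fun n => ∑ j ∈ range (n + 1), |c n j|)
              (fun n _ => sum_nonneg fun j _ => abs_nonneg _) hmem
    rw [hC]; linarith
  refine ⟨C, hCpos, fun K V τ hV hτ η hη => ?_⟩
  -- node values are small
  have hnode : ∀ n ∈ range N, ∀ j ∈ range (n + 1),
      |∑ k, V k * Real.cos (τ k * (2 + j * h))| ≤ η := by
    intro n hn j hj
    have hn' : (n : ℝ) + 1 ≤ N := by exact_mod_cast (mem_range.mp hn)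
    have hj' : (j : ℝ) ≤ n := by exact_mod_cast Nat.lt_succ_iff.mp (mem_range.mp hj)
    refine hη _ (by nlinarith [hh]) ?_
    have : (j : ℝ) * h ≤ (N : ℝ) * h := mul_le_mul_of_nonneg_right (by linarith) hh.le
    linarith
  -- `η ≥ 0` (the window is nonempty)
  have hη0 : 0 ≤ η := le_trans (abs_nonneg _) (hη 2 le_rfl (by norm_num))
  -- split `Σ V = Σ V(1 − P) + Σ V P`
  set P : ℝ → ℝ := fun t => ∑ n ∈ range N, ∑ j ∈ range (n + 1), c n j * Real.cos ((2 + j * h) * t)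
    with hP
  have hPk : ∀ k, |1 - P (τ k)| ≤ 1 / 2 := fun k =>
    abs_one_sub_nodeApprox_le hh hθh hθ2h hNθ hNf (hτ k).1 (hτ k).2
  have h1 : ∑ k, V k * (1 - P (τ k)) ≤ ∑ k, V k * (1 / 2) :=
    sum_le_sum fun k _ => mul_le_mul_of_nonneg_left (le_trans (le_abs_self _) (hPk k)) (hV k)
  have h2 : ∑ k, V k * P (τ k)
      = ∑ n ∈ range N, ∑ j ∈ range (n + 1), c n j * ∑ k, V k * Real.cos (τ k * (2 + j * h)) := by
    have e : ∀ k, V k * P (τ k)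
        = ∑ n ∈ range N, ∑ j ∈ range (n + 1), c n j * (V k * Real.cos (τ k * (2 + j * h))) := by
      intro k
      rw [hP]
      simp only [mul_sum]
      refine sum_congr rfl fun n _ => sum_congr rfl fun j _ => ?_
      rw [mul_comm ((2 : ℝ) + j * h) (τ k)]
      ring
    simp_rw [e]
    rw [sum_comm]
    refine sum_congr rfl fun n _ => ?_
    rw [sum_comm]
    refine sum_congr rfl fun j _ => ?_
    rw [mul_sum]
  have h3 : ∑ k, V k * P (τ k) ≤ (C / 2) * η := by
    rw [h2]
    calc ∑ n ∈ range N, ∑ j ∈ range (n + 1), c n j * ∑ k, V k * Real.cos (τ k * (2 + j * h))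
        ≤ ∑ n ∈ range N, ∑ j ∈ range (n + 1), |c n j| * η := by
          refine sum_le_sum fun n hn => sum_le_sum fun j hj => ?_
          calc c n j * ∑ k, V k * Real.cos (τ k * (2 + j * h))
              ≤ |c n j * ∑ k, V k * Real.cos (τ k * (2 + j * h))| := le_abs_self _
            _ = |c n j| * |∑ k, V k * Real.cos (τ k * (2 + j * h))| := abs_mul _ _
            _ ≤ |c n j| * η := mul_le_mul_of_nonneg_left (hnode n hn j hj) (abs_nonneg _)
      _ = (∑ n ∈ range N, ∑ j ∈ range (n + 1), |c n j|) * η := by simp_rw [Finset.sum_mul]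
      _ = (C / 2) * η := by rw [hC]; ring
  have hsplit : ∑ k, V k = ∑ k, V k * (1 - P (τ k)) + ∑ k, V k * P (τ k) := by
    rw [← sum_add_distrib]; refine sum_congr rfl fun k _ => ?_; ring
  have h4 : ∑ k, V k * (1 / 2 : ℝ) = (∑ k, V k) / 2 := by rw [← sum_mul]; ring
  have hVsum : ∑ k, V k ≤ (∑ k, V k) / 2 + (C / 2) * η := by
    rw [hsplit]
    calc ∑ k, V k * (1 - P (τ k)) + ∑ k, V k * P (τ k)
        ≤ ∑ k, V k * (1 / 2) + (C / 2) * η := add_le_add h1 h3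
      _ = (∑ k, V k * (1 - P (τ k)) + ∑ k, V k * P (τ k)) / 2 + (C / 2) * η := by
          rw [h4, ← hsplit]
  linarith

end Summit.RiemannHypothesis.RiemannHypothesis.Theorems.IntegerScrew.Manifest

end
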